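import Literature.Geometry.Kaehler.ComplexTorusInverseLefschetzKleiman
import Literature.Geometry.Kaehler.ComplexTorusCycleEndomorphismsProductRule
import Literature.Geometry.Kaehler.ComplexTorusDivisorClassesLowCodimension
import Literature.Geometry.Kaehler.ComplexTorusDivisorClassesPrimitive
import Literature.Geometry.Kaehler.ComplexTorusHodgeClassesPerfectPairing
import HarnessLib

/-!
# Milne 1999, Prop. 5.7 for the Lefschetz operators of Thm. 5.9, and Prop. 5.2, at torus level:
# `D•(X)` is stable under `ᶜΛ`, the primitive projectors, Kleiman's `Λ`, `∗`, `Λᵗ`, `∗⁻¹`, and the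
# cup pairing `Dᵖ × D^{g-p} → ℚ` is perfect; Kleiman's `A(X, L)` for Lefschetz classes

Layer `Literature/Geometry/Kaehler`, namespace `Literature.Geometry.Kaehler.ComplexTorus`; lane
`lit-hodgefound` (Track 2 foundations library), Layer A4, prover seat `lit-hodgefound-p08` (generation 8,
row g8-#1 «Q518⁺ · Q633⁺ · (g7-#3)⁺ · A4-20⁺ · A4-24⁺⁺⁺⁺»). Sequel of
`ComplexTorusLefschetzDual.lean` (A4-54: the dual Lefschetz operator `ᶜΛ = lefschetzDual η m`, the
contraction `Σᵢ fᵢ ⌟ eᵢ ⌟` of a symplectic frame, `lefschetzDual_mem_hodgeClasses`),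
`ComplexTorusKleimanLefschetzOperators.lean` (Q633: `π_{m,r} = primitiveProj`, Kleiman's
`Λ = kleimanDual`, `lefschetzSignOp`, `∗ = lefschetzStar` as polynomials in `L` and `ᶜΛ`,
`aeval_lagrangeBasis_apply_mem`), `ComplexTorusInverseLefschetzKleiman.lean` (g7-#3: `Λᵗ = kleimanDualPow`,
`∗⁻¹ = lefschetzStarInv`), `ComplexTorusDivisorClasses*.lean` (A4-20 / A4-24: `Dᵖ(X) = divisorClasses Φ p`,
the `ℚ`-span of the wedge monomials `E₁ ∧ ⋯ ∧ E_p`, `Eᵢ ∈ NS(X)`; `D⁰ = H⁰_Hodge`, `D¹ = H²_Hodge`,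
`Dᵖ ∧ D^q ⊆ D^{p+q}`), of `ComplexTorusCycleEndomorphismsProductRule.lean` (p09: the interior product
`x ⌟ ·` is an antiderivation of the ring `GForm E ℂ` of graded forms, `curryLeftG_mul`, Warner 2.11 (b))
of `LinearAlgebra/Alternating/GradedFormsRing.lean` (the ring of graded forms, `of_mul_of`, `negDeg`) and,
for §5, of `ComplexTorusHodgeClassesPerfectPairing.lean` (A4-41: Voisin's form `Q = lefschetzIntersectionForm`,
Hodge–Riemann on rational primitive `(p,p)`-classes, BFNP (6.1) on `H^{2•}_Hodge`).
Everything is consumed BY NAME; nothing is restated.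

## Source, verbatim

J. S. Milne, *Lefschetz classes on abelian varieties*, Duke Math. J. 96 (1999) 639–675, held
`paper:doi-10-1215-s0012-7094-99-09620-5`:
* p. 664 (p0026 L22–L25): "**Proposition 5.7.** Let `A` and `B` be abelian varieties over `Ω`. A
  cohomological correspondence `u` between `A` and `B` is Lefschetz if and only if `ū : H∗(A) → H∗(B)`
  commutes with the actions of `L(A × B)`. If `u` is Lefschetz, then `ū` maps `D(A)_k` into `D(B)_k`."
* p. 664 (p0026 L74–75): "**Theorem 5.9.** Let `A` be an abelian variety over `Ω`. The correspondences
  `Λ`, `ᶜΛ`, and `∗` between `A` and itself are all Lefschetz."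
* p. 665 (p0027 L1–L8): "Proof. It is known (e.g., Kleiman 1968, p367) that `Λ`, regarded as a map of
  cohomology groups, is inverse to `L`. Since the latter is Lefschetz, it commutes with the action of
  `L(A)`, which implies that the same is true of `Λ`, which is therefore Lefschetz. Consequently, all
  elements of the `Q`-algebra `Q[L, Λ]` are Lefschetz. Since this algebra contains `ᶜΛ` and `∗` (Kleiman
  1968, 1.4.4), this completes the proof."
* p. 662 (p0024 L31–33): "**Proposition 5.1.** For any abelian variety `A`, `D_hom(A)_k` is a graded
  subalgebra of `H^{2∗}(A)(∗)`".
* p. 662 (p0024 L52–53): "**Proposition 5.2.** Let `A` be an abelian variety over `Ω`. For any nonzero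
  `a ∈ D_hom(A)_k`, there exists `b ∈ D_hom(B)_k such that a · b = 0`." — so the held text; by the
  proof that follows it ("the nondegenerate pairing `H^{2s}(A)(s) × H^{2g-2s}(A)(g-s) → H^{2g}(A)(g) ≅ k` …
  induces a nondegenerate pairing `D^s_hom(A)_k × D^{g-s}_hom(A)_k → k`") the statement is: for any
  non-zero `a ∈ D^s(A)` there is `b ∈ D^{g-s}(A)` with `a · b ≠ 0`, which is what is formalised.

## Reading at torus level, and what is proved (theorems only; no definition, no named fact, net debt 0)

`X = E/Φ(ℤ^ι)` a complex torus, `η ∈ NS(X)` NON-DEGENERATE (every polarised torus / abelian variety);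
`Dᵖ(X) = divisorClasses Φ p ⊆ H^{2p}(X, ℂ) = Alt^{2p}_ℝ(E; ℂ)` = Milne's Lefschetz classes `D(A)` read in
Betti cohomology (the `ℚ`-algebra generated by the divisor classes; Lefschetz `(1,1)`); the operators
`ū` for `u ∈ {ᶜΛ, π_{m,r}, Λ, ∗, Λᵗ, ∗⁻¹}` are the tree's `lefschetzDual`, `primitiveProj`, `kleimanDual`,
`lefschetzSignOp`, `lefschetzStar`, `kleimanDualPow`, `lefschetzStarInv` on invariant forms. The
conclusion of Prop. 5.7 for these `u` ("`ū` maps `D(A)` into `D(A)`") is PROVED: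

* §3 MAIN **`lefschetzDual_mem_divisorClasses`: `γ ∈ D^{p+1}(X) ⇒ ᶜΛγ ∈ Dᵖ(X)`** (+ the degree-indexed
  form `lefschetzDual_mem_divisorClasses'`);
* §4 `lefschetzPow_mem_divisorClasses` (`Lʳ Dᵖ ⊆ D^{r+p}`, Prop. 5.1), `lefschetzDualL_apply_mem_divisorClasses`,
  **`primitiveProj_apply_mem_divisorClasses`** (the Lefschetz components `Lʳγ_r` of a divisor class are
  divisor classes), **`kleimanDual_apply_mem_divisorClasses`** (+ `'`), `lefschetzSignOp_apply_mem_divisorClasses`,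
  **`lefschetzStar_apply_mem_divisorClasses`**, **`kleimanDualPow_apply_mem_divisorClasses`**
  (`(L^t)⁻¹ = Λᵗ` preserves `D•`), `lefschetzStarInv_apply_mem_divisorClasses`, and the primitive
  decomposition INSIDE `D•(X)`: **`exists_primitive_mem_divisorClasses_add_lefschetzPow`**
  (`γ = γ₀ + Lβ`, `γ₀ ∈ D^{p+1}` primitive, `β = Λγ ∈ Dᵖ`, `2p + 2 ≤ g`) and
  `primitiveProj_zero_apply_mem_divisorClasses_inf_primitiveForms`.

PROOF. It deviates from the printed one: Milne's proof rests on his Thm. 3.2 / Cor. 4.5 (the Lefschetz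
classes are exactly the `L(A)`-invariants — classical invariant theory, not in the tree). Here, directly
on invariant forms: in a symplectic frame `(eᵢ, fᵢ)` of `η`, `ᶜΛ = Σᵢ fᵢ ⌟ eᵢ ⌟`
(`IsSymplecticBasis.lefschetzDual_eq`), and the interior product is an antiderivation of `∧` (Warner 2.11
(b)), whence on the ring of graded forms `GForm E ℂ` (where degrees are internal and no transport along
equations of degrees occurs) the SECOND-ORDER LEIBNIZ RULE
`y ⌟ x ⌟ (uv) = (y ⌟ x ⌟ u) v + u (y ⌟ x ⌟ v) + (negDeg (x ⌟ u)(y ⌟ v) - negDeg (y ⌟ u)(x ⌟ v))`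
(§1 `curryLeftG_curryLeftG_mul`, `sum_curryLeftG_curryLeftG_mul`), with a MIXED TERM
`M(u, v) = Σᵢ (negDeg (eᵢ ⌟ u)(fᵢ ⌟ v) - negDeg (fᵢ ⌟ u)(eᵢ ⌟ v))` which is a derivation in `u` against
central parity-even factors (`sum_mixed_mul_of_comm`). Read on homogeneous forms (§2, `GForm.of`,
`of_mul_of`, `of_injective`): **`contractFrame_wedge_two`**
`Λ_b(γ ∧ E) = (Λ_b γ) ∧ E + (Λ_b E) γ + (-1)^{m+1} M_b(γ, E)` (`deg γ = m + 2`, `E` a `2`-form,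
`M_b(γ, E) = Σᵢ (eᵢ ⌟ γ ∧ fᵢ ⌟ E - fᵢ ⌟ γ ∧ eᵢ ⌟ E)`, written out as a sum) and **`mixed_wedge_two`**
`M_b(γ ∧ E', E) = M_b(γ, E) ∧ E' + (-1)^m γ ∧ M_b(E', E)`. §3: the `(1,1)`-LEMMA
`IsSymplecticBasis.mixed_mem_divisorClasses_one`: for `E', E ∈ NS(X)`,
`M_b(E', E) = (ᶜΛE') E + (ᶜΛE) E' - ᶜΛ(E' ∧ E)` is a rational `(1,1)`-class (`lefschetzDual_mem_hodgeClasses`),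
i.e. a divisor class (`divisorClasses_one_eq_hodgeClasses`, Lefschetz `(1,1)`); then induction over the
monomials `E₀ ∧ ⋯ ∧ E_p` (`IsSymplecticBasis.mixed_wedgeFamily_mem_divisorClasses`,
`IsSymplecticBasis.contractFrame_wedgeFamily_mem_divisorClasses`; `ᶜΛE ∈ D⁰ = ℚ`) and `ℚ`-span
induction. §4 is "all elements of the `ℚ`-algebra `ℚ[L, Λ]`" exactly as Q633 §7 did it for `H•(X, ℚ)`
and `H^{2•}_Hodge(X)` (Lagrange polynomials with rational nodes in `ᶜΛ ∘ L`).

* §5 (polarised torus, `η` a Riemann form; Milne's Prop. 5.2):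
  **`IsRiemannForm.eq_zero_of_forall_mem_divisorClasses_lefschetzIntersectionForm_eq_zero`** (Voisin's
  `Q_{2p,r}` is non-degenerate on `Dᵖ`, `2p + r = g`) and its second-variable form,
  **`IsRiemannForm.exists_mem_divisorClasses_torusIntegral_wedge_ne_zero`** (`0 ≠ x ∈ Dᵖ ⇒ ∃ y ∈ D^q,
  ∫_X x ∧ y ≠ 0`, `p + q = g`) and `…'`, **`IsRiemannForm.isPerfPair_poincarePairingRat_divisorClasses`**
  (the `ℚ`-valued Poincaré pairing restricted to `Dᵖ × D^q` is a perfect pairing). Milne's printed proof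
  ("Because `L(A)` acts semisimply …") again uses the Lefschetz group; here the partner is found INSIDE
  `D•` by the primitive decomposition in `D•` (§4) + Hodge–Riemann, and above the middle degree by the
  descent `x = L^{p-q} Λ^{p-q} x` with `Λ^{p-q} x ∈ D^q` (§4, row g7-#3).

* §6 (Kleiman's `A(X, L)` for Lefschetz classes — Milne 1999 p. 665: "Most of (Kleiman 1968) can now be
  rewritten with 'variety' replaced by 'abelian variety' and 'algebraic cycle' with 'Lefschetz cycle'";
  Milne 2002, Introduction: "`L^{n-r}` is assumed to be an isomorphism for `n ≥ r`, and `L^{n-r} = (L^{r-n})⁻¹`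
  for `n < r`"): `exists_mem_divisorClasses_lefschetzPow_eq` (`x = Lᵗ(Λᵗx)` inside `D•`),
  **`lefschetzPow_bijOn_divisorClasses`** (`Lᵗ : Dᵖ(X) ⥲ D^{p+t}(X)` for `2p + t = g`),
  `finrank_divisorClasses_eq_of_two_mul_add_eq` (`dim_ℚ Dᵖ = dim_ℚ D^{g-p}`), and
  **`divisorClasses_eq_hodgeClasses_iff_of_two_mul_add_eq`** (`Dᵖ = H^{2p}_Hodge ↔ D^{g-p} = H^{2(g-p)}_Hodge`;
  the direction "upper ⇒ lower" is new, the other is A4-24⁺⁺⁺'s `divisorClasses_eq_hodgeClasses_of_two_mul_add_eq`).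

NOT here: the first statement of Prop. 5.7 and Thm. 3.2 (the Lefschetz group side), correspondences on
`X × X` (rows Q518 / Q605: the kernel classes of `ᶜΛ` and `L` are divisor classes on `X × X`).

## References

* [Milne1999LefschetzClasses] J. S. Milne, *Lefschetz classes on abelian varieties*, Duke Math. J. 96
  (1999), §5: Prop. 5.1, Prop. 5.2 (p. 662), Prop. 5.7, Thm. 5.9 (p. 664), proof of Thm. 5.9 and
  Rem. 5.11 (p. 665).
* [Lange2023AbelianVarietiesComplex] H. Lange, *Abelian Varieties over the Complex Numbers* (2023),
  §7.3.1 (`D•(X)`), §7.3.2 (Lefschetz operator, primitive forms, (3) Lefschetz decomposition).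
* [Voisin2002] C. Voisin, *Hodge Theory and Complex Algebraic Geometry I* (2002), §6.2.1 Lemma 6.19
  (`Λ`), §6.2.3 Rem. 6.27, §6.3.2 Lemma 6.31 / Thm. 6.32, §7.1.2, §7.2 Lemma 7.26.
* [WarnerGTM94] F. W. Warner, *Foundations of Differentiable Manifolds and Lie Groups*, GTM 94 (1983),
  2.6, 2.11 (b) (interior multiplication is an antiderivation).
* [Kleiman1968AlgebraicCycles] S. Kleiman, *Algebraic cycles and the Weil conjectures* (1968), §1.4
  (1.4.4), as quoted by Milne.
* [Milne2002Polarizations] J. S. Milne, *Polarizations and Grothendieck's standard conjectures*, Ann. of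
  Math. (2) 155 (2002), 599–610, Introduction pp. 599–600 (the Lefschetz standard conjecture; "for abelian
  varieties … the operator `Λ` is defined by a Lefschetz class").
-/

noncomputable section

set_option maxSynthPendingDepth 3

open Module Finset
open Literature.LinearAlgebra.Alternating
open Literature.LinearAlgebra.Alternating.GForm (of of_mul_of curryLeftG negDeg IsHomog)

namespace Literature.Geometry.Kaehler

namespace ComplexTorus

/-! ## §1 The second-order Leibniz rule of a double contraction on the ring of graded forms -/

section Graded

variable {E : Type*} [NormedAddCommGroup E] [NormedSpace ℂ E] [FiniteDimensional ℂ E]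

omit [FiniteDimensional ℂ E] in
/-- An annihilation operator anticommutes with the parity operator up to the degree shift:
`x ⌟ (negDeg w) = -negDeg (x ⌟ w)`. [cite: WarnerGTM94, 2.11] -/
theorem curryLeftG_negDeg (x : E) (w : GForm E ℂ) :
    curryLeftG x (negDeg w) = -negDeg (curryLeftG x w) := by
  funext m
  rw [GForm.curryLeftG_apply, GForm.negDeg_apply, Pi.neg_apply, GForm.negDeg_apply,
    GForm.curryLeftG_apply, pow_succ, mul_neg_one, neg_smul]
  ext v
  simp only [ContinuousAlternatingMap.curryLeft_apply_apply, ContinuousAlternatingMap.smul_apply,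
    ContinuousAlternatingMap.neg_apply]

/-- **The second-order Leibniz rule of a double contraction** `y ⌟ x ⌟` on the ring of graded forms
(twice Warner's antiderivation rule 2.11 (b), `curryLeftG_mul`):
`y ⌟ x ⌟ (u v) = (y ⌟ x ⌟ u) v + u (y ⌟ x ⌟ v) + (negDeg (x ⌟ u) (y ⌟ v) - negDeg (y ⌟ u) (x ⌟ v))`.
[cite: WarnerGTM94, 2.11 (b)] -/
theorem curryLeftG_curryLeftG_mul (x y : E) (u v : GForm E ℂ) :
    curryLeftG y (curryLeftG x (u * v)) =
      curryLeftG y (curryLeftG x u) * v + u * curryLeftG y (curryLeftG x v) +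
        (negDeg (curryLeftG x u) * curryLeftG y v - negDeg (curryLeftG y u) * curryLeftG x v) := by
  rw [curryLeftG_mul, map_add, curryLeftG_mul, curryLeftG_mul, curryLeftG_negDeg, GForm.negDeg_negDeg,
    neg_mul]
  abel

variable {n : ℕ} (e f : Fin n → E)

/-- **The second-order Leibniz rule for a frame double contraction** `Λ = Σᵢ fᵢ ⌟ eᵢ ⌟` on the ring of
graded forms: `Λ(u v) = (Λu) v + u (Λv) + M(u, v)` with the mixed term
`M(u, v) = Σᵢ (negDeg (eᵢ ⌟ u) (fᵢ ⌟ v) - negDeg (fᵢ ⌟ u) (eᵢ ⌟ v))`. [cite: WarnerGTM94, 2.11 (b)] -/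
theorem sum_curryLeftG_curryLeftG_mul (u v : GForm E ℂ) :
    ∑ i, curryLeftG (f i) (curryLeftG (e i) (u * v)) =
      (∑ i, curryLeftG (f i) (curryLeftG (e i) u)) * v + u * ∑ i, curryLeftG (f i) (curryLeftG (e i) v) +
        ∑ i, (negDeg (curryLeftG (e i) u) * curryLeftG (f i) v -
          negDeg (curryLeftG (f i) u) * curryLeftG (e i) v) := by
  simp only [curryLeftG_curryLeftG_mul, Finset.sum_add_distrib, Finset.sum_mul, Finset.mul_sum]

/-- **The mixed term is a derivation in its first slot against central parity-even factors**: for `w`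
central with `negDeg w = w` (e.g. homogeneous of even degree),
`M(u w, v) = M(u, v) w + u M(w, v)`. [cite: WarnerGTM94, 2.11 (b)] -/
theorem sum_mixed_mul_of_comm (u v w : GForm E ℂ) (hw : ∀ z : GForm E ℂ, w * z = z * w)
    (hw' : negDeg w = w) :
    ∑ i, (negDeg (curryLeftG (e i) (u * w)) * curryLeftG (f i) v -
        negDeg (curryLeftG (f i) (u * w)) * curryLeftG (e i) v) =
      (∑ i, (negDeg (curryLeftG (e i) u) * curryLeftG (f i) v -
          negDeg (curryLeftG (f i) u) * curryLeftG (e i) v)) * w +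
        u * ∑ i, (negDeg (curryLeftG (e i) w) * curryLeftG (f i) v -
          negDeg (curryLeftG (f i) w) * curryLeftG (e i) v) := by
  rw [Finset.sum_mul, Finset.mul_sum, ← Finset.sum_add_distrib]
  refine Finset.sum_congr rfl fun i _ ↦ ?_
  have h1 : negDeg (curryLeftG (e i) (u * w)) = negDeg (curryLeftG (e i) u) * w + u * negDeg (curryLeftG (e i) w) := by
    rw [curryLeftG_mul, GForm.negDeg_add, GForm.negDeg_mul, GForm.negDeg_mul, GForm.negDeg_negDeg, hw']
  have h2 : negDeg (curryLeftG (f i) (u * w)) = negDeg (curryLeftG (f i) u) * w + u * negDeg (curryLeftG (f i) w) := by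
    rw [curryLeftG_mul, GForm.negDeg_add, GForm.negDeg_mul, GForm.negDeg_mul, GForm.negDeg_negDeg, hw']
  have h3 : negDeg (curryLeftG (e i) u) * w * curryLeftG (f i) v =
      negDeg (curryLeftG (e i) u) * curryLeftG (f i) v * w := by
    rw [mul_assoc, hw, ← mul_assoc]
  have h4 : negDeg (curryLeftG (f i) u) * w * curryLeftG (e i) v =
      negDeg (curryLeftG (f i) u) * curryLeftG (e i) v * w := by
    rw [mul_assoc, hw, ← mul_assoc]
  rw [h1, h2, add_mul, add_mul, h3, h4, sub_mul, mul_sub, mul_assoc u, mul_assoc u]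
  abel

end Graded

/-! ## §2 Reading the rule on homogeneous forms: `Λ_b(γ ∧ E)` for a `2`-form `E` -/

section Homogeneous

variable {E : Type*} [NormedAddCommGroup E] [NormedSpace ℂ E] [FiniteDimensional ℂ E] {n : ℕ}
  (e f : Fin n → E)

omit [FiniteDimensional ℂ E] in
/-- The frame double contraction of a homogeneous graded form: `Σᵢ fᵢ ⌟ eᵢ ⌟ (of (m+2) γ) =
of m (Σᵢ fᵢ ⌟ eᵢ ⌟ γ)`. [cite: WarnerGTM94, 2.11] -/
theorem sum_curryLeftG_curryLeftG_of (m : ℕ) (γ : E [⋀^Fin (m + 2)]→L[ℝ] ℂ) :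
    ∑ i, curryLeftG (f i) (curryLeftG (e i) (of (m + 2) γ)) =
      of m (∑ i, (γ.curryLeft (e i)).curryLeft (f i)) := by
  rw [GForm.of_sum]
  refine Finset.sum_congr rfl fun i _ ↦ ?_
  rw [GForm.curryLeftG_of_succ, GForm.curryLeftG_of_succ]

omit [FiniteDimensional ℂ E] in
/-- The mixed term on homogeneous graded forms `of (m+2) γ`, `of 2 E`:
`M = (-1)^{m+1} • of (m+2) (Σᵢ (eᵢ ⌟ γ ∧ fᵢ ⌟ E - fᵢ ⌟ γ ∧ eᵢ ⌟ E))`. [cite: WarnerGTM94, 2.11 (b)] -/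
theorem sum_mixed_of_of (m : ℕ) (γ : E [⋀^Fin (m + 2)]→L[ℝ] ℂ) (θ : E [⋀^Fin 2]→L[ℝ] ℂ) :
    ∑ i, (negDeg (curryLeftG (e i) (of (m + 2) γ)) * curryLeftG (f i) (of 2 θ) -
        negDeg (curryLeftG (f i) (of (m + 2) γ)) * curryLeftG (e i) (of 2 θ)) =
      ((-1 : ℝ) ^ (m + 1)) • of (m + 2) (∑ i, ((γ.curryLeft (e i)).wedge (θ.curryLeft (f i)) -
        (γ.curryLeft (f i)).wedge (θ.curryLeft (e i)))) := by
  rw [GForm.of_sum, Finset.smul_sum]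
  refine Finset.sum_congr rfl fun i _ ↦ ?_
  rw [GForm.curryLeftG_of_succ, GForm.curryLeftG_of_succ, GForm.curryLeftG_of_succ, GForm.curryLeftG_of_succ,
    GForm.negDeg_of, GForm.negDeg_of, GForm.smul_mul, GForm.smul_mul, of_mul_of, of_mul_of, ← smul_sub,
    ← GForm.of_sub]

omit [FiniteDimensional ℂ E] in
/-- A `0`-form is the constant `0`-form of its value. [folklore] -/
private theorem eq_constOfIsEmpty₀ (c : E [⋀^Fin 0]→L[ℝ] ℂ) :
    c = ContinuousAlternatingMap.constOfIsEmpty ℝ E (Fin 0) (c ![]) := by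
  ext v
  rw [ContinuousAlternatingMap.constOfIsEmpty_apply]
  exact congrArg c (Subsingleton.elim _ _)

omit [FiniteDimensional ℂ E] in
/-- A `0`-form as a right factor of a wedge is the scalar it is: `γ ∧ c = c(∅) • γ`. [cite: WarnerGTM94, 2.6] -/
theorem wedge_zeroForm_eq_smul {k : ℕ} (γ : E [⋀^Fin k]→L[ℝ] ℂ) (c : E [⋀^Fin 0]→L[ℝ] ℂ) :
    γ.wedge c = (c ![]) • γ := by
  conv_lhs => rw [eq_constOfIsEmpty₀ c]
  exact wedge_constOfIsEmpty' γ (c ![])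

/-- **The second-order Leibniz rule for `Σᵢ fᵢ ⌟ eᵢ ⌟` through a wedge with a `2`-form**, read on
components: for `γ` of degree `m + 2` and a `2`-form `E`,
`Λ(γ ∧ E) = (Λγ) ∧ E + (ΛE) γ + (-1)^{m+1} Σᵢ (eᵢ ⌟ γ ∧ fᵢ ⌟ E - fᵢ ⌟ γ ∧ eᵢ ⌟ E)`
(`ΛE = Σᵢ E(eᵢ, fᵢ)` a scalar). [cite: WarnerGTM94, 2.11 (b)] -/
theorem sum_curryLeft_curryLeft_wedge_two (m : ℕ) (γ : E [⋀^Fin (m + 2)]→L[ℝ] ℂ)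
    (θ : E [⋀^Fin 2]→L[ℝ] ℂ) :
    ∑ i, ((γ.wedge θ).curryLeft (e i)).curryLeft (f i) =
      (∑ i, (γ.curryLeft (e i)).curryLeft (f i)).wedge θ +
        ((∑ i, (θ.curryLeft (e i)).curryLeft (f i)) ![]) • γ +
        ((-1 : ℝ) ^ (m + 1)) • ∑ i, ((γ.curryLeft (e i)).wedge (θ.curryLeft (f i)) -
          (γ.curryLeft (f i)).wedge (θ.curryLeft (e i))) := by
  apply GForm.of_injective (m + 2)
  have h := sum_curryLeftG_curryLeftG_mul e f (of (m + 2) γ) (of 2 θ)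
  rw [sum_curryLeftG_curryLeftG_of, sum_curryLeftG_curryLeftG_of e f 0 θ, sum_mixed_of_of, of_mul_of,
    of_mul_of, of_mul_of, sum_curryLeftG_curryLeftG_of, wedge_zeroForm_eq_smul] at h
  rw [h, GForm.of_add, GForm.of_add, GForm.of_smul, GForm.of_smul]

variable (b : Module.Basis (Fin n ⊕ Fin n) ℝ E)

/-- **The second-order Leibniz rule for the frame contraction `Λ_b = Σᵢ fᵢ ⌟ eᵢ ⌟` of A4-54 through a wedge
with a `2`-form**: `Λ_b(γ ∧ E) = (Λ_b γ) ∧ E + (Λ_b E) γ + (-1)^{m+1} M_b(γ, E)`, `deg γ = m + 2`, with the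
mixed term `M_b(γ, E) = Σᵢ (eᵢ ⌟ γ ∧ fᵢ ⌟ E - fᵢ ⌟ γ ∧ eᵢ ⌟ E)`. [cite: WarnerGTM94, 2.11 (b)]
[cite: Voisin2002, §6.2.1 Lemma 6.19] -/
theorem contractFrame_wedge_two (m : ℕ) (γ : E [⋀^Fin (m + 2)]→L[ℝ] ℂ) (θ : E [⋀^Fin 2]→L[ℝ] ℂ) :
    contractFrame b (m + 2) (γ.wedge θ) =
      (contractFrame b m γ).wedge θ + (contractFrame b 0 θ ![]) • γ +
        ((-1 : ℝ) ^ (m + 1)) • ∑ i, ((γ.curryLeft (b (Sum.inl i))).wedge (θ.curryLeft (b (Sum.inr i))) -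
          (γ.curryLeft (b (Sum.inr i))).wedge (θ.curryLeft (b (Sum.inl i)))) := by
  rw [contractFrame_apply, contractFrame_apply, contractFrame_apply]
  exact sum_curryLeft_curryLeft_wedge_two (fun i ↦ b (Sum.inl i)) (fun i ↦ b (Sum.inr i)) m γ θ

/-- **The mixed term is a derivation in the first slot on even forms**: for `γ` of degree `m + 2` and
`2`-forms `E'`, `E`, `M_b(γ ∧ E', E) = M_b(γ, E) ∧ E' + (-1)^m γ ∧ M_b(E', E)` (on the ring of graded
forms `E'` is central and parity-even). [cite: WarnerGTM94, 2.11 (b)] -/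
theorem mixed_wedge_two (m : ℕ) (γ : E [⋀^Fin (m + 2)]→L[ℝ] ℂ) (θ' θ : E [⋀^Fin 2]→L[ℝ] ℂ) :
    ∑ i, (((γ.wedge θ').curryLeft (b (Sum.inl i))).wedge (θ.curryLeft (b (Sum.inr i))) -
        ((γ.wedge θ').curryLeft (b (Sum.inr i))).wedge (θ.curryLeft (b (Sum.inl i)))) =
      (∑ i, ((γ.curryLeft (b (Sum.inl i))).wedge (θ.curryLeft (b (Sum.inr i))) -
          (γ.curryLeft (b (Sum.inr i))).wedge (θ.curryLeft (b (Sum.inl i))))).wedge θ' +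
        ((-1 : ℝ) ^ m) • γ.wedge (∑ i, ((θ'.curryLeft (b (Sum.inl i))).wedge (θ.curryLeft (b (Sum.inr i))) -
          (θ'.curryLeft (b (Sum.inr i))).wedge (θ.curryLeft (b (Sum.inl i))))) := by
  apply GForm.of_injective (m + 2 + 2)
  have hc : ∀ z : GForm E ℂ, of 2 θ' * z = z * of 2 θ' := GForm.of_mul_comm_of_even (by decide) θ'
  have hn : negDeg (of 2 θ') = of 2 θ' := by rw [GForm.negDeg_of]; norm_num
  have h := sum_mixed_mul_of_comm (fun i ↦ b (Sum.inl i)) (fun i ↦ b (Sum.inr i)) (of (m + 2) γ) (of 2 θ)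
    (of 2 θ') hc hn
  rw [of_mul_of, sum_mixed_of_of, sum_mixed_of_of, sum_mixed_of_of (fun i ↦ b (Sum.inl i))
    (fun i ↦ b (Sum.inr i)) 0 θ', GForm.smul_mul, GForm.mul_smul, of_mul_of, of_mul_of] at h
  have hs1 : ((-1 : ℝ) ^ (m + 2 + 1)) = (-1 : ℝ) ^ (m + 1) := by
    rw [show m + 2 + 1 = m + 1 + 2 by ring, pow_add]; norm_num
  have hs2 : (-1 : ℝ) ^ (m + 1) * (-1 : ℝ) ^ (m + 1) = 1 := by
    rw [← mul_pow, neg_one_mul, neg_neg, one_pow]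
  have hs3 : (-1 : ℝ) ^ (m + 1) * (-1 : ℝ) ^ (0 + 1) = (-1 : ℝ) ^ m := by
    rw [← pow_add, show m + 1 + (0 + 1) = m + 2 by ring, pow_add]; norm_num
  rw [hs1] at h
  have key : of (m + 2 + 2) (∑ i, (((γ.wedge θ').curryLeft (b (Sum.inl i))).wedge (θ.curryLeft (b (Sum.inr i))) -
      ((γ.wedge θ').curryLeft (b (Sum.inr i))).wedge (θ.curryLeft (b (Sum.inl i))))) =
      ((-1 : ℝ) ^ (m + 1)) • (((-1 : ℝ) ^ (m + 1)) • of (m + 2 + 2)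
        (∑ i, (((γ.wedge θ').curryLeft (b (Sum.inl i))).wedge (θ.curryLeft (b (Sum.inr i))) -
          ((γ.wedge θ').curryLeft (b (Sum.inr i))).wedge (θ.curryLeft (b (Sum.inl i)))))) := by
    rw [smul_smul, hs2, one_smul]
  rw [key, h, smul_add, smul_smul, smul_smul, hs2, one_smul, hs3, GForm.of_add, GForm.of_smul]

end Homogeneous

/-! ## §3 `ᶜΛ` maps `D^{p+1}(X)` into `Dᵖ(X)` -/

section Divisor

variable {ι : Type*} [Fintype ι] {E : Type*} [NormedAddCommGroup E] [NormedSpace ℂ E]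
  [FiniteDimensional ℂ E] (Φ : (ι → ℝ) ≃L[ℝ] E) {η : E [⋀^Fin 2]→L[ℝ] ℝ} {n : ℕ}
  {b : Module.Basis (Fin n ⊕ Fin n) ℝ E}

omit [Fintype ι] [FiniteDimensional ℂ E] in
/-- A `0`-form divisor class is a rational scalar: `c ∈ D⁰(X)`, `γ ∈ Dᵖ(X)` give `c(∅) • γ ∈ Dᵖ(X)`
(`D⁰ = ℚ · 1`). [cite: Lange2023AbelianVarietiesComplex, §7.3.1] -/
theorem apply_smul_mem_divisorClasses_of_mem_zero {c : E [⋀^Fin 0]→L[ℝ] ℂ} (hc : c ∈ divisorClasses Φ 0)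
    {p : ℕ} {γ : E [⋀^Fin (2 * p)]→L[ℝ] ℂ} (hγ : γ ∈ divisorClasses Φ p) :
    (c ![]) • γ ∈ divisorClasses Φ p := by
  rw [divisorClasses_zero, Submodule.mem_span_singleton] at hc
  obtain ⟨q, rfl⟩ := hc
  have e : ((q • Literature.Analysis.Complex.oneForm₀ E) ![]) • γ = q • γ := by
    rw [ContinuousAlternatingMap.smul_apply, Literature.Analysis.Complex.oneForm₀_apply, ← Rat.cast_smul_eq_qsmul ℂ q,
      ← Rat.cast_smul_eq_qsmul ℂ q, smul_eq_mul, mul_one]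
  rw [e]
  exact Submodule.smul_mem _ q hγ

/-- **The `(1,1)`-lemma for the mixed term.** For a symplectic frame `b` of a non-degenerate `η ∈ NS(X)`
and `E', E ∈ NS(X)`, the `2`-form `M_b(E', E) = Σᵢ (eᵢ ⌟ E' ∧ fᵢ ⌟ E - fᵢ ⌟ E' ∧ eᵢ ⌟ E)` is a divisor
class: by the second-order Leibniz rule `M_b(E', E) = (ᶜΛE') E + (ᶜΛE) E' - ᶜΛ(E' ∧ E)`, each term a
rational `(1,1)`-class (`lefschetzDual_mem_hodgeClasses`), and `H²_Hodge(X) = D¹(X)` (Lefschetz `(1,1)`).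
(In the dictionary `NS_ℚ(X) ≅ End^s_ℚ(X)`, `E = η(φ·, ·)`, it is `-η((φ'φ + φφ')·, ·)`.)
[cite: Milne1999LefschetzClasses, §5 Prop. 5.7 / Thm. 5.9] [cite: Lange2023AbelianVarietiesComplex, §7.3.1] -/
theorem IsSymplecticBasis.mixed_mem_divisorClasses_one (hb : IsSymplecticBasis η b) (hη : IsNSForm Φ η)
    (hnd : ∀ v : E, v ≠ 0 → ∃ w : E, η ![v, w] ≠ 0) {θ' θ : E [⋀^Fin 2]→L[ℝ] ℝ} (hθ' : IsNSForm Φ θ')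
    (hθ : IsNSForm Φ θ) :
    ∑ i, (((ofRealForm θ').curryLeft (b (Sum.inl i))).wedge ((ofRealForm θ).curryLeft (b (Sum.inr i))) -
        ((ofRealForm θ').curryLeft (b (Sum.inr i))).wedge ((ofRealForm θ).curryLeft (b (Sum.inl i)))) ∈
      divisorClasses Φ 1 := by
  have h := contractFrame_wedge_two b 0 (ofRealForm θ') (ofRealForm θ)
  have hs : ((-1 : ℝ) ^ (0 + 1)) = -1 := by norm_num
  rw [hs, neg_one_smul, ← sub_eq_add_neg, eq_sub_iff_add_eq, ← eq_sub_iff_add_eq'] at h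
  have h1 : ofRealForm θ' ∈ hodgeClasses Φ 1 := ofRealForm_mem_hodgeClasses_one Φ hθ'
  have h2 : ofRealForm θ ∈ hodgeClasses Φ 1 := ofRealForm_mem_hodgeClasses_one Φ hθ
  have h1' : ofRealForm θ' ∈ hodgeClassesIn Φ (0 + 2) (0 + 1) := h1
  have h2' : ofRealForm θ ∈ hodgeClassesIn Φ (0 + 2) (0 + 1) := h2
  have h1'' : ofRealForm θ' ∈ hodgeClassesIn Φ 2 1 := h1
  have h2'' : ofRealForm θ ∈ hodgeClassesIn Φ 2 1 := h2
  have hA : (lefschetzDual η 0 (ofRealForm θ')).wedge (ofRealForm θ) ∈ hodgeClassesIn Φ 2 1 :=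
    wedge_mem_hodgeClassesIn Φ (lefschetzDual_mem_hodgeClassesIn Φ hη hnd h1') h2''
  have hB : (ofRealForm θ').wedge (lefschetzDual η 0 (ofRealForm θ)) ∈ hodgeClassesIn Φ 2 1 :=
    wedge_mem_hodgeClassesIn Φ h1'' (lefschetzDual_mem_hodgeClassesIn Φ hη hnd h2')
  have h12 : (ofRealForm θ').wedge (ofRealForm θ) ∈ hodgeClassesIn Φ (2 + 2) (1 + 1) :=
    wedge_mem_hodgeClassesIn Φ h1'' h2''
  have hC : lefschetzDual η 2 ((ofRealForm θ').wedge (ofRealForm θ)) ∈ hodgeClassesIn Φ 2 1 :=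
    lefschetzDual_mem_hodgeClassesIn Φ hη hnd h12
  have hABC := Submodule.sub_mem _ (Submodule.add_mem _ hA hB) hC
  rw [wedge_zeroForm_eq_smul, hb.lefschetzDual_eq, hb.lefschetzDual_eq] at hABC
  have hD : divisorClasses Φ 1 = hodgeClassesIn Φ 2 1 := divisorClasses_one_eq_hodgeClasses Φ
  rw [hD, h]
  exact hABC

/-- **The mixed term of a wedge monomial of divisor classes is a divisor class**:
`M_b(E₀ ∧ ⋯ ∧ E_p, E) ∈ D^{p+1}(X)` for `Eᵢ, E ∈ NS(X)` — induction on `p` with the derivation rule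
`mixed_wedge_two` (`M_b(γ ∧ E', E) = M_b(γ, E) ∧ E' + γ ∧ M_b(E', E)` on even forms) and the
`(1,1)`-lemma. [cite: Milne1999LefschetzClasses, §5 Prop. 5.7 / Thm. 5.9]
[cite: Lange2023AbelianVarietiesComplex, §7.3.1] -/
theorem IsSymplecticBasis.mixed_wedgeFamily_mem_divisorClasses (hb : IsSymplecticBasis η b)
    (hη : IsNSForm Φ η) (hnd : ∀ v : E, v ≠ 0 → ∃ w : E, η ![v, w] ≠ 0) {θ : E [⋀^Fin 2]→L[ℝ] ℝ}
    (hθ : IsNSForm Φ θ) :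
    ∀ (p : ℕ) (ζ : Fin (p + 1) → E [⋀^Fin 2]→L[ℝ] ℝ), (∀ i, IsNSForm Φ (ζ i)) →
      ∑ i, (((wedgeFamily (p + 1) fun i ↦ ofRealForm (ζ i)).curryLeft (b (Sum.inl i))).wedge
          ((ofRealForm θ).curryLeft (b (Sum.inr i))) -
        ((wedgeFamily (p + 1) fun i ↦ ofRealForm (ζ i)).curryLeft (b (Sum.inr i))).wedge
          ((ofRealForm θ).curryLeft (b (Sum.inl i)))) ∈ divisorClasses Φ (p + 1)
  | 0, ζ, hζ => by
    rw [wedgeFamily_one]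
    exact hb.mixed_mem_divisorClasses_one Φ hη hnd (hζ 0) hθ
  | p + 1, ζ, hζ => by
    rw [wedgeFamily_succ, mixed_wedge_two b (2 * p)]
    refine Submodule.add_mem _ ?_ ?_
    · exact wedge_ofRealForm_mem_divisorClasses Φ
        (hb.mixed_wedgeFamily_mem_divisorClasses hη hnd hθ p _ fun i ↦ hζ _) (hζ (Fin.last (p + 1)))
    · rw [pow_mul, neg_one_sq, one_pow, one_smul]
      exact wedge_mem_divisorClasses Φ (wedgeFamily_mem_divisorClasses Φ _ fun i ↦ hζ _)
        (hb.mixed_mem_divisorClasses_one Φ hη hnd (hζ (Fin.last (p + 1))) hθ)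

/-- **`ᶜΛ` of a wedge monomial of divisor classes is a divisor class**: `Λ_b(E₀ ∧ ⋯ ∧ E_p) ∈ Dᵖ(X)`
for `Eᵢ ∈ NS(X)` — induction on `p` with the second-order Leibniz rule `contractFrame_wedge_two`
(`Λ(γ ∧ E) = (Λγ) ∧ E + (ΛE) γ - M(γ, E)` on even forms), `ΛE ∈ D⁰ = ℚ` and the mixed-term lemma.
[cite: Milne1999LefschetzClasses, §5 Prop. 5.7 / Thm. 5.9] [cite: Lange2023AbelianVarietiesComplex, §7.3.1] -/
theorem IsSymplecticBasis.contractFrame_wedgeFamily_mem_divisorClasses (hb : IsSymplecticBasis η b)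
    (hη : IsNSForm Φ η) (hnd : ∀ v : E, v ≠ 0 → ∃ w : E, η ![v, w] ≠ 0) :
    ∀ (p : ℕ) (ζ : Fin (p + 1) → E [⋀^Fin 2]→L[ℝ] ℝ), (∀ i, IsNSForm Φ (ζ i)) →
      contractFrame b (2 * p) (wedgeFamily (p + 1) fun i ↦ ofRealForm (ζ i)) ∈ divisorClasses Φ p
  | 0, ζ, hζ => by
    rw [wedgeFamily_one, divisorClasses_zero_eq_hodgeClasses, ← hb.lefschetzDual_eq]
    exact lefschetzDual_mem_hodgeClasses Φ hη hnd (p := 0) (ofRealForm_mem_hodgeClasses_one Φ (hζ 0))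
  | p + 1, ζ, hζ => by
    rw [wedgeFamily_succ]
    show contractFrame b (2 * p + 2) ((wedgeFamily (p + 1) (Fin.init fun i ↦ ofRealForm (ζ i))).wedge
      (ofRealForm (ζ (Fin.last (p + 1))))) ∈ divisorClasses Φ (p + 1)
    rw [contractFrame_wedge_two b (2 * p)]
    refine Submodule.add_mem _ (Submodule.add_mem _ ?_ ?_) ?_
    · exact wedge_ofRealForm_mem_divisorClasses Φ
        (hb.contractFrame_wedgeFamily_mem_divisorClasses hη hnd p _ fun i ↦ hζ _) (hζ (Fin.last (p + 1)))
    · refine apply_smul_mem_divisorClasses_of_mem_zero Φ ?_ (wedgeFamily_mem_divisorClasses Φ _ fun i ↦ hζ _)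
      rw [divisorClasses_zero_eq_hodgeClasses, ← hb.lefschetzDual_eq]
      exact lefschetzDual_mem_hodgeClasses Φ hη hnd (p := 0)
        (ofRealForm_mem_hodgeClasses_one Φ (hζ (Fin.last (p + 1))))
    · rw [pow_succ, pow_mul, neg_one_sq, one_pow, one_mul, neg_one_smul]
      exact Submodule.neg_mem _
        (hb.mixed_wedgeFamily_mem_divisorClasses Φ hη hnd (hζ (Fin.last (p + 1))) p _ fun i ↦ hζ _)

omit [FiniteDimensional ℂ E] in
/-- `ℚ`-scalars pass through a `ℂ`-linear map of invariant forms. [folklore] -/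
private theorem map_ratSmul {k l : ℕ} (f : (E [⋀^Fin k]→L[ℝ] ℂ) →ₗ[ℂ] (E [⋀^Fin l]→L[ℝ] ℂ)) (c : ℚ)
    (x : E [⋀^Fin k]→L[ℝ] ℂ) : f (c • x) = c • f x := by
  rw [← Rat.cast_smul_eq_qsmul ℂ c, map_smul, Rat.cast_smul_eq_qsmul]

/-- **Milne 1999, Prop. 5.7 for `u = ᶜΛ` (Thm. 5.9), at torus level: `ᶜΛ` maps `D^{p+1}(X)` into
`Dᵖ(X)`.** For a complex torus `X = E/Φ(ℤ^ι)` and a non-degenerate `η ∈ NS(X)` (every polarised torus /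
abelian variety), the dual Lefschetz operator `Λ = Σᵢ fᵢ ⌟ eᵢ ⌟` of row A4-54 (`lefschetzDual η`, Milne's
and Kleiman's `ᶜΛ`, the `sl₂`-partner of `L = η ∧ ·`) maps the divisor classes of codimension `p + 1` — the
`ℚ`-span of the monomials `E₀ ∧ ⋯ ∧ E_p`, `Eᵢ ∈ NS(X)`, Milne's Lefschetz classes `D(A)` read in Betti
cohomology — to divisor classes of codimension `p`. Milne: "If `u` is Lefschetz, then `ū` maps `D(A)_k`
into `D(B)_k`" (Prop. 5.7) and "The correspondences `Λ`, `ᶜΛ`, and `∗` between `A` and itself are all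
Lefschetz" (Thm. 5.9). The printed proof goes through Milne's Thm. 3.2 / Cor. 4.5 (Lefschetz classes are
the `L(A)`-invariants); here the statement is proved directly on invariant forms by the second-order
Leibniz rule of `Σᵢ fᵢ ⌟ eᵢ ⌟` (`contractFrame_wedge_two`) and Lefschetz `(1,1)`.
[cite: Milne1999LefschetzClasses, §5 Prop. 5.7 and Thm. 5.9] [cite: Lange2023AbelianVarietiesComplex, §7.3.1] -/
theorem lefschetzDual_mem_divisorClasses (hη : IsNSForm Φ η) (hnd : ∀ v : E, v ≠ 0 → ∃ w : E, η ![v, w] ≠ 0)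
    {p : ℕ} {γ : E [⋀^Fin (2 * (p + 1))]→L[ℝ] ℂ} (hγ : γ ∈ divisorClasses Φ (p + 1)) :
    lefschetzDual η (2 * p) γ ∈ divisorClasses Φ p := by
  obtain ⟨b, hb⟩ := exists_isSymplecticBasis hnd
  rw [hb.lefschetzDual_eq]
  rw [divisorClasses] at hγ
  induction hγ using Submodule.span_induction with
  | mem x hx =>
    obtain ⟨ζ, rfl⟩ := hx
    exact hb.contractFrame_wedgeFamily_mem_divisorClasses Φ hη hnd p (fun i ↦ (ζ i : E [⋀^Fin 2]→L[ℝ] ℝ))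
      fun i ↦ (ζ i).2
  | zero => rw [map_zero]; exact Submodule.zero_mem _
  | add x y _ _ hx hy => rw [map_add]; exact Submodule.add_mem _ hx hy
  | smul c x _ hx => rw [map_ratSmul]; exact Submodule.smul_mem _ c hx

/-- Degree-indexed form of `lefschetzDual_mem_divisorClasses`: `ᶜΛ` maps the divisor classes read in
degree `m + 2 = 2(p+1)` to those of degree `m = 2p`. [cite: Milne1999LefschetzClasses, §5 Prop. 5.7 and Thm. 5.9] -/
theorem lefschetzDual_mem_divisorClasses' (hη : IsNSForm Φ η) (hnd : ∀ v : E, v ≠ 0 → ∃ w : E, η ![v, w] ≠ 0)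
    {m p : ℕ} (hm : 2 * p = m) {γ : E [⋀^Fin (m + 2)]→L[ℝ] ℂ}
    (hγ : γ.domDomCongr (finCongr (by omega : m + 2 = 2 * (p + 1))) ∈ divisorClasses Φ (p + 1)) :
    (lefschetzDual η m γ).domDomCongr (finCongr hm.symm) ∈ divisorClasses Φ p := by
  subst hm
  exact lefschetzDual_mem_divisorClasses Φ hη hnd hγ

end Divisor

/-! ## §4 All of `ℚ[L, ᶜΛ]` preserves `D•(X)`: primitive projectors, Kleiman's `Λ`, `∗`, `Λᵗ`, `∗⁻¹` -/

section Operators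

variable {ι : Type*} [Fintype ι] {E : Type*} [NormedAddCommGroup E] [NormedSpace ℂ E]
  [FiniteDimensional ℂ E] (Φ : (ι → ℝ) ≃L[ℝ] E) {η : E [⋀^Fin 2]→L[ℝ] ℝ}

omit [Fintype ι] [FiniteDimensional ℂ E] in
/-- **`Lʳ` maps `Dᵖ(X)` into `D^{r+p}(X)`** for `η ∈ NS(X)` (`E^{∧r} ∧ Dᵖ ⊆ D^{r+p}`, the tree's
`wedgePow_wedge_mem_divisorClasses` re-indexed for the bundled `lefschetzPow η r`; Milne: cupping with a
Lefschetz class preserves Lefschetz classes, Prop. 5.1 / proof of Prop. 5.7).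
[cite: Milne1999LefschetzClasses, §5 Prop. 5.1 and Prop. 5.7 (proof)]
[cite: Lange2023AbelianVarietiesComplex, §7.3.1] -/
theorem lefschetzPow_mem_divisorClasses (hη : IsNSForm Φ η) (r : ℕ) {p q : ℕ} (hq : r + p = q)
    {ψ : E [⋀^Fin (2 * p)]→L[ℝ] ℂ} (hψ : ψ ∈ divisorClasses Φ p) :
    lefschetzPow η r (show 2 * r + 2 * p = 2 * q by omega) ψ ∈ divisorClasses Φ q := by
  subst hq
  rw [lefschetzPow_apply]
  exact wedgePow_wedge_mem_divisorClasses Φ hη r hψ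

/-- `ᶜΛ ∘ L` preserves `Dᵖ(X)`. [cite: Milne1999LefschetzClasses, §5 Prop. 5.7 and Thm. 5.9] -/
theorem lefschetzDualL_apply_mem_divisorClasses (hη : IsNSForm Φ η)
    (hnd : ∀ v : E, v ≠ 0 → ∃ w : E, η ![v, w] ≠ 0) {p : ℕ} {x : E [⋀^Fin (2 * p)]→L[ℝ] ℂ}
    (hx : x ∈ divisorClasses Φ p) : lefschetzDualL η (2 * p) x ∈ divisorClasses Φ p :=
  lefschetzDual_mem_divisorClasses Φ hη hnd
    (lefschetzPow_mem_divisorClasses Φ hη 1 (show 1 + p = p + 1 by omega) hx)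

/-- **The Lefschetz components of a divisor class are divisor classes**: the primitive projectors
`π_{2p,r}` (Lagrange polynomials in `ᶜΛ ∘ L` with rational nodes, row Q633) map `Dᵖ(X)` into itself —
"all elements of the `ℚ`-algebra `ℚ[L, Λ]` are Lefschetz" (Milne, proof of Thm. 5.9) read through
Prop. 5.7 on `D(A)`: in `γ = Σ_r Lʳ γ_r` (`γ_r` primitive) every `Lʳ γ_r` is a divisor class when `γ` is.
[cite: Milne1999LefschetzClasses, §5 Prop. 5.7 and Thm. 5.9 (proof)] -/
theorem primitiveProj_apply_mem_divisorClasses (hη : IsNSForm Φ η)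
    (hnd : ∀ v : E, v ≠ 0 → ∃ w : E, η ![v, w] ≠ 0) {p : ℕ} (r : ℕ) {x : E [⋀^Fin (2 * p)]→L[ℝ] ℂ}
    (hx : x ∈ divisorClasses Φ p) : primitiveProj η (2 * p) r x ∈ divisorClasses Φ p :=
  aeval_lagrangeBasis_apply_mem (divisorClasses Φ p)
    (fun _ hy ↦ lefschetzDualL_apply_mem_divisorClasses Φ hη hnd hy)
    (w := fun j ↦ lefschetzWeight (finrank ℂ E) (2 * p + 2) (j + 1)) (fun _ ↦ rfl) _ _ hx

/-- **Kleiman's `Λ` maps `D^{p+1}(X)` into `Dᵖ(X)`** (Milne, Thm. 5.9 with Prop. 5.7: "`Λ`, regarded as a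
map of cohomology groups, is inverse to `L`. Since the latter is Lefschetz … the same is true of `Λ`").
[cite: Milne1999LefschetzClasses, §5 Prop. 5.7 and Thm. 5.9] -/
theorem kleimanDual_apply_mem_divisorClasses (hη : IsNSForm Φ η)
    (hnd : ∀ v : E, v ≠ 0 → ∃ w : E, η ![v, w] ≠ 0) {p : ℕ} {x : E [⋀^Fin (2 * (p + 1))]→L[ℝ] ℂ}
    (hx : x ∈ divisorClasses Φ (p + 1)) : kleimanDual η (2 * p) x ∈ divisorClasses Φ p := by
  rw [kleimanDual_apply]
  refine Submodule.sum_mem _ fun r _ ↦ ?_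
  rw [lefschetzNode_eq, ← Rat.cast_inv, Rat.cast_smul_eq_qsmul ℂ]
  exact Submodule.smul_mem _ _ (primitiveProj_apply_mem_divisorClasses Φ hη hnd r
    (lefschetzDual_mem_divisorClasses Φ hη hnd hx))

/-- Degree-indexed form of `kleimanDual_apply_mem_divisorClasses` (source read in degree `m + 2`,
`m = 2p`). [cite: Milne1999LefschetzClasses, §5 Prop. 5.7 and Thm. 5.9] -/
theorem kleimanDual_apply_mem_divisorClasses' (hη : IsNSForm Φ η)
    (hnd : ∀ v : E, v ≠ 0 → ∃ w : E, η ![v, w] ≠ 0) {m p : ℕ} (hm : 2 * p = m)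
    {x : E [⋀^Fin (m + 2)]→L[ℝ] ℂ}
    (hx : x.domDomCongr (finCongr (by omega : m + 2 = 2 * (p + 1))) ∈ divisorClasses Φ (p + 1)) :
    (kleimanDual η m x).domDomCongr (finCongr hm.symm) ∈ divisorClasses Φ p := by
  subst hm
  exact kleimanDual_apply_mem_divisorClasses Φ hη hnd hx

/-- The sign operator `Σ_r ε_r π_{2p,r}` preserves `Dᵖ(X)`. [cite: Milne1999LefschetzClasses, §5 Thm. 5.9 (proof)] -/
theorem lefschetzSignOp_apply_mem_divisorClasses (hη : IsNSForm Φ η)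
    (hnd : ∀ v : E, v ≠ 0 → ∃ w : E, η ![v, w] ≠ 0) {p : ℕ} {x : E [⋀^Fin (2 * p)]→L[ℝ] ℂ}
    (hx : x ∈ divisorClasses Φ p) : lefschetzSignOp η (2 * p) x ∈ divisorClasses Φ p := by
  rw [lefschetzSignOp, LinearMap.sum_apply]
  refine Submodule.sum_mem _ fun r _ ↦ ?_
  rw [LinearMap.smul_apply, Rat.cast_smul_eq_qsmul ℂ]
  exact Submodule.smul_mem _ _ (primitiveProj_apply_mem_divisorClasses Φ hη hnd r hx)

/-- **Kleiman's `∗` maps `Dᵖ(X)` into `D^{j+p}(X)`** (below the middle degree: `∗ = L^j Σ_r ε_r π_{2p,r}`,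
`2p + j = g`; Milne, Thm. 5.9: "the correspondences `Λ`, `ᶜΛ`, and `∗` … are all Lefschetz", with
Prop. 5.7). [cite: Milne1999LefschetzClasses, §5 Prop. 5.7 and Thm. 5.9] -/
theorem lefschetzStar_apply_mem_divisorClasses (hη : IsNSForm Φ η)
    (hnd : ∀ v : E, v ≠ 0 → ∃ w : E, η ![v, w] ≠ 0) (j : ℕ) {p q : ℕ} (hjq : j + p = q)
    (h : 2 * j + 2 * p = 2 * q) {x : E [⋀^Fin (2 * p)]→L[ℝ] ℂ} (hx : x ∈ divisorClasses Φ p) :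
    lefschetzStar η j h x ∈ divisorClasses Φ q :=
  lefschetzPow_mem_divisorClasses Φ hη j hjq (lefschetzSignOp_apply_mem_divisorClasses Φ hη hnd hx)

/-- **`Λᵗ` maps `D^{p+t}(X)` into `Dᵖ(X)`** (the source read in degree `2p + 2t`): the inverse
`(Lᵗ)⁻¹ = Λᵗ` of the hard Lefschetz isomorphism (row g7-#3, Milne Rem. 5.11 / Scholl (5.9.1)) preserves
Lefschetz classes. [cite: Milne1999LefschetzClasses, §5 Prop. 5.7, Thm. 5.9 and Rem. 5.11] -/
theorem kleimanDualPow_apply_mem_divisorClasses (hη : IsNSForm Φ η)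
    (hnd : ∀ v : E, v ≠ 0 → ∃ w : E, η ![v, w] ≠ 0) (p : ℕ) :
    ∀ (t : ℕ) {q : ℕ} (hq : p + t = q) {x : E [⋀^Fin (2 * p + 2 * t)]→L[ℝ] ℂ},
      x.domDomCongr (finCongr (by omega : 2 * p + 2 * t = 2 * q)) ∈ divisorClasses Φ q →
        kleimanDualPow η (2 * p) t x ∈ divisorClasses Φ p
  | 0, q, hq, x, hx => by
    subst hq
    exact hx
  | t + 1, q, hq, x, hx => by
    rw [kleimanDualPow_succ_apply]
    refine kleimanDualPow_apply_mem_divisorClasses hη hnd p t rfl ?_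
    have hx' := domDomCongr_mem_divisorClasses Φ (show q = p + t + 1 by omega) hx
    rw [domDomCongr_finCongr_trans] at hx'
    have h := kleimanDual_apply_mem_divisorClasses' Φ hη hnd (m := 2 * p + 2 * t) (p := p + t)
      (Nat.left_distrib 2 p t) (x := x) hx'
    simpa only [domDomCongr_finCongr_trans] using h

/-- **`∗` above the middle degree (`∗⁻¹ = (Σ_r ε_r π_r) ∘ Λʲ`, row g7-#3) maps `D^{p+j}(X)` into `Dᵖ(X)`.**
[cite: Milne1999LefschetzClasses, §5 Prop. 5.7, Thm. 5.9 and Rem. 5.11] -/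
theorem lefschetzStarInv_apply_mem_divisorClasses (hη : IsNSForm Φ η)
    (hnd : ∀ v : E, v ≠ 0 → ∃ w : E, η ![v, w] ≠ 0) (p j : ℕ) {x : E [⋀^Fin (2 * p + 2 * j)]→L[ℝ] ℂ}
    (hx : x.domDomCongr (finCongr ((Nat.left_distrib 2 p j).symm)) ∈ divisorClasses Φ (p + j)) :
    lefschetzStarInv η (2 * p) j x ∈ divisorClasses Φ p :=
  lefschetzSignOp_apply_mem_divisorClasses Φ hη hnd (kleimanDualPow_apply_mem_divisorClasses Φ hη hnd p j rfl hx)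

/-- **The primitive decomposition of a divisor class stays inside `D•(X)`**: on a complex torus with a
non-degenerate `η ∈ NS(X)`, every `γ ∈ D^{p+1}(X)` with `2(p+1) ≤ g` is `γ = γ₀ + η ∧ β` with `γ₀` a
PRIMITIVE divisor class of codimension `p + 1` and `β ∈ Dᵖ(X)` — indeed `β = Λγ` (Kleiman's `Λ`,
`Λ L = id` below the middle degree) and `γ₀ = γ - LΛγ`. The Hodge-class version is row A4-24⁺⁺'s
`exists_primitive_hodgeClass_add_lefschetzPow`; with it, the criterion of
`ComplexTorusDivisorClassesPrimitive.lean` compares `D^{p+1}` and `H^{2p+2}_Hodge` summand by summand.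
[cite: Milne1999LefschetzClasses, §5 Prop. 5.7 and Thm. 5.9] [cite: Lange2023AbelianVarietiesComplex, §7.3.2 (3)] -/
theorem exists_primitive_mem_divisorClasses_add_lefschetzPow (hη : IsNSForm Φ η)
    (hnd : ∀ v : E, v ≠ 0 → ∃ w : E, η ![v, w] ≠ 0) {p : ℕ} (hp : 2 * (p + 1) ≤ finrank ℂ E)
    {γ : E [⋀^Fin (2 * (p + 1))]→L[ℝ] ℂ} (hγ : γ ∈ divisorClasses Φ (p + 1)) :
    ∃ (γ₀ : E [⋀^Fin (2 * (p + 1))]→L[ℝ] ℂ) (β : E [⋀^Fin (2 * p)]→L[ℝ] ℂ),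
      γ₀ ∈ primitiveForms η (2 * (p + 1)) ∧ γ₀ ∈ divisorClasses Φ (p + 1) ∧ β ∈ divisorClasses Φ p ∧
        β = kleimanDual η (2 * p) γ ∧ γ = γ₀ + lefschetzPow η 1 (show 2 * 1 + 2 * p = 2 * (p + 1) by omega) β := by
  obtain ⟨γ₀, hγ₀, β, e⟩ := exists_mem_primitiveForms_add_lefschetzPow hnd
    (show 2 * 1 + 2 * p = 2 * (p + 1) by omega) hp γ
  have hβ : kleimanDual η (2 * p) γ = β := by
    have h1 := kleimanDual_lefschetzPow_one hnd (m := 2 * p) (by omega) (by omega) β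
    rw [e, map_add, kleimanDual_eq_zero_of_mem_primitiveForms hnd (m := 2 * p) (by omega) hγ₀, zero_add]
    exact h1
  have hβD : β ∈ divisorClasses Φ p := hβ ▸ kleimanDual_apply_mem_divisorClasses Φ hη hnd hγ
  refine ⟨γ₀, β, hγ₀, ?_, hβD, hβ.symm, e⟩
  rw [eq_sub_of_add_eq e.symm]
  exact Submodule.sub_mem _ hγ (lefschetzPow_mem_divisorClasses Φ hη 1 (Nat.add_comm 1 p) hβD)

/-- **The primitive part of a divisor class is a divisor class**: `π_{2p+2,0} γ ∈ D^{p+1}(X) ∩ P^{2p+2}`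
for `γ ∈ D^{p+1}(X)`, `2p + 2 ≤ g`. [cite: Milne1999LefschetzClasses, §5 Prop. 5.7 and Thm. 5.9] -/
theorem primitiveProj_zero_apply_mem_divisorClasses_inf_primitiveForms (hη : IsNSForm Φ η)
    (hnd : ∀ v : E, v ≠ 0 → ∃ w : E, η ![v, w] ≠ 0) {p : ℕ} (hp : 2 * (p + 1) ≤ finrank ℂ E)
    {γ : E [⋀^Fin (2 * (p + 1))]→L[ℝ] ℂ} (hγ : γ ∈ divisorClasses Φ (p + 1)) :
    primitiveProj η (2 * (p + 1)) 0 γ ∈ divisorClasses Φ (p + 1) ∧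
      primitiveProj η (2 * (p + 1)) 0 γ ∈ primitiveForms η (2 * (p + 1)) := by
  refine ⟨primitiveProj_apply_mem_divisorClasses Φ hη hnd 0 hγ,
    (mem_primitiveForms_iff_primitiveProj_zero_apply_eq hnd hp _).2 ?_⟩
  have h := LinearMap.congr_fun (primitiveProj_mul hnd (by omega : 2 * (p + 1) ≤ 2 * finrank ℂ E) 0 0) γ
  rwa [if_pos rfl, Module.End.mul_apply] at h

end Operators

/-! ## §5 Milne's Prop. 5.2 at torus level: the cup pairing is non-degenerate on `D•(X)` -/

section Pairing

variable {ι : Type*} [Fintype ι] [DecidableEq ι] {E : Type*} [NormedAddCommGroup E] [NormedSpace ℂ E]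
  [FiniteDimensional ℂ E] (Φ : (ι → ℝ) ≃L[ℝ] E) {η : E [⋀^Fin 2]→L[ℝ] ℝ}

/-- **Voisin's form `Q_{2p,r} = ∫_X ω^{∧r} ∧ · ∧ ·` is NON-DEGENERATE on the divisor classes `Dᵖ(X)` of a
polarised complex torus** (`2p + r = g`): a divisor class `x` with `Q(x, y) = 0` for every divisor class
`y` of the same codimension is `0`. Proof = the one of `ComplexTorusHodgeClassesPerfectPairing.lean`
(Voisin's Lemma 7.26 run over `ℚ`) INSIDE `D•(X)`: induction on `p` through the primitive decomposition
`x = x₀ + Lβ` with `x₀ ∈ Dᵖ` primitive and `β = Λx ∈ D^{p-1}` (`exists_primitive_mem_divisorClasses_add_lefschetzPow`,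
this file), the orthogonality `Q(x₀, Lβ') = 0`, the shift `Q(Lβ, Lβ') = Q(β, β')` (Lemma 6.31) and
Thm. 6.32 on the primitive part. [cite: Milne1999LefschetzClasses, §5 Prop. 5.2]
[cite: Voisin2002, §6.3.2 Lemma 6.31, Thm. 6.32] -/
theorem IsRiemannForm.eq_zero_of_forall_mem_divisorClasses_lefschetzIntersectionForm_eq_zero
    (hη : IsRiemannForm Φ η) {g : ℕ} (e : Fin (2 * g) ≃ ι) :
    ∀ {p r : ℕ} (hkr : 2 * p + r = g) {x : E [⋀^Fin (2 * p)]→L[ℝ] ℂ}, x ∈ divisorClasses Φ p →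
      (∀ y ∈ divisorClasses Φ p, lefschetzIntersectionForm Φ η e hkr x y = 0) → x = 0 := by
  have hg : finrank ℂ E = g := finrank_eq_of_finTwoMulEquiv Φ e
  have hNS : IsNSForm Φ η := hη.isNSForm Φ
  have hnd : ∀ v : E, v ≠ 0 → ∃ w : E, η ![v, w] ≠ 0 := IsRiemannForm.exists_apply_ne_zero Φ hη
  intro p
  induction p with
  | zero =>
    intro r hkr x hx h
    refine hη.eq_zero_of_mem_primitiveForms_of_lefschetzIntersectionForm_self_eq_zero Φ e hkr
      (divisorClasses_le_hodgeClasses Φ 0 hx) ?_ (h x hx)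
    rw [primitiveForms_eq_top_of_le_one η (by omega)]
    trivial
  | succ p ih =>
    intro r hkr x hx h
    have hp : 2 * (p + 1) ≤ finrank ℂ E := by omega
    obtain ⟨x₀, β, hx₀P, hx₀D, hβ, -, hdec⟩ := exists_primitive_mem_divisorClasses_add_lefschetzPow Φ hNS hnd hp hx
    -- `Q(β, ·) = 0` on `Dᵖ`, hence `β = 0` by induction
    have hβ0 : β = 0 := by
      refine ih (r := r + 2) (by omega) hβ fun β' hβ' ↦ ?_
      have hy : lefschetzPow η 1 (show 2 * 1 + 2 * p = 2 * (p + 1) by omega) β' ∈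
          divisorClasses Φ (p + 1) :=
        lefschetzPow_mem_divisorClasses Φ hNS 1 (Nat.add_comm 1 p) hβ'
      have h0 := h _ hy
      rw [hdec, map_add, LinearMap.add_apply,
        lefschetzIntersectionForm_lefschetzPow_one_eq_zero_of_mem_primitiveForms Φ η e _ hkr hx₀P β',
        zero_add, lefschetzIntersectionForm_lefschetzPow_one Φ η e _ hkr (by omega) β β'] at h0
      exact h0
    rw [hβ0, LinearMap.map_zero, add_zero] at hdec
    rw [hdec] at hx h ⊢
    exact hη.eq_zero_of_mem_primitiveForms_of_lefschetzIntersectionForm_self_eq_zero Φ e hkr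
      (divisorClasses_le_hodgeClasses Φ _ hx) hx₀P (h x₀ hx)

/-- Non-degeneracy of `Q` on `Dᵖ(X)` in the SECOND variable (`Q` is symmetric in even degree).
[cite: Milne1999LefschetzClasses, §5 Prop. 5.2] -/
theorem IsRiemannForm.eq_zero_of_forall_mem_divisorClasses_lefschetzIntersectionForm_eq_zero'
    (hη : IsRiemannForm Φ η) {g : ℕ} (e : Fin (2 * g) ≃ ι) {p r : ℕ} (hkr : 2 * p + r = g)
    {y : E [⋀^Fin (2 * p)]→L[ℝ] ℂ} (hy : y ∈ divisorClasses Φ p)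
    (h : ∀ x ∈ divisorClasses Φ p, lefschetzIntersectionForm Φ η e hkr x y = 0) : y = 0 := by
  refine hη.eq_zero_of_forall_mem_divisorClasses_lefschetzIntersectionForm_eq_zero Φ e hkr hy fun x hx ↦ ?_
  rw [lefschetzIntersectionForm_flip, h x hx, mul_zero]

/-- **Milne 1999, Prop. 5.2, at torus level: "For any nonzero `a ∈ D^s(A)`, there exists `b ∈ D^{g-s}(A)`
such that `a · b ≠ 0`"** — for a complex torus `X = E/Φ(ℤ^ι)` with a Riemann form `η` (a polarised
abelian variety), `p + q = g`, and a non-zero divisor class `x ∈ Dᵖ(X)`, there is a divisor class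
`y ∈ D^q(X)` with `∫_X x ∧ y ≠ 0`: the cup-product pairing `Dᵖ(X) × D^q(X) → ℚ` is non-degenerate.
Milne's printed proof ("Because `L(A)` acts semisimply …") uses the Lefschetz group; here: for `p ≤ q`
the partner is `L^{q-p} y'` with `Q(x, y') ≠ 0` (non-degeneracy of `Q` on `Dᵖ`, Hodge–Riemann); for
`p > q` one descends INSIDE `D•` by `x = L^{p-q} Λ^{p-q} x` (`Λ^{p-q} x ∈ D^q`,
`kleimanDualPow_apply_mem_divisorClasses`; the inverse of hard Lefschetz, row g7-#3) and pairs `Λ^{p-q} x`.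
[cite: Milne1999LefschetzClasses, §5 Prop. 5.2] [cite: Voisin2002, §6.3.2 Thm. 6.32] -/
theorem IsRiemannForm.exists_mem_divisorClasses_torusIntegral_wedge_ne_zero (hη : IsRiemannForm Φ η)
    {g : ℕ} (e : Fin (2 * g) ≃ ι) {p q : ℕ} (hpq : p + q = g) (h2 : 2 * p + 2 * q = 2 * g)
    {x : E [⋀^Fin (2 * p)]→L[ℝ] ℂ} (hx : x ∈ divisorClasses Φ p) (hx0 : x ≠ 0) :
    ∃ y ∈ divisorClasses Φ q, torusIntegral Φ e ((x.wedge y).domDomCongr (finCongr h2)) ≠ 0 := by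
  have hg : finrank ℂ E = g := finrank_eq_of_finTwoMulEquiv Φ e
  have hNS : IsNSForm Φ η := hη.isNSForm Φ
  have hnd : ∀ v : E, v ≠ 0 → ∃ w : E, η ![v, w] ≠ 0 := IsRiemannForm.exists_apply_ne_zero Φ hη
  rcases le_or_gt p q with hle | hlt
  · -- `q = p + r`, `2p + r = g`: partner `L^r y'`
    obtain ⟨r, rfl⟩ := Nat.exists_eq_add_of_le hle
    have hkr : 2 * p + r = g := by omega
    obtain ⟨y', hy', hQ⟩ : ∃ y' ∈ divisorClasses Φ p, lefschetzIntersectionForm Φ η e hkr x y' ≠ 0 := by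
      by_contra! hall
      exact hx0 (hη.eq_zero_of_forall_mem_divisorClasses_lefschetzIntersectionForm_eq_zero Φ e hkr hx hall)
    refine ⟨lefschetzPow η r (show 2 * r + 2 * p = 2 * (p + r) by ring) y',
      lefschetzPow_mem_divisorClasses Φ hNS r (Nat.add_comm r p) hy', ?_⟩
    rw [lefschetzIntersectionForm_eq_neg_one_pow_mul Φ η e hkr (by omega)] at hQ
    rw [lefschetzPow_apply, wedge_domDomCongr_finCongr, domDomCongr_finCongr_trans,
      wedge_wedgePow_wedge_eq (ofRealForm η) r x y', domDomCongr_finCongr_trans]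
    exact fun h0 ↦ hQ (by rw [h0, mul_zero])
  · -- `p = q + s`, `2q + s = g`: descend `x = L^s (Λ^s x)` inside `D•` and pair `Λ^s x`
    obtain ⟨s, rfl⟩ := Nat.exists_eq_add_of_le hlt.le
    have hqs : 2 * q + s = finrank ℂ E := by omega
    have hd : 2 * (q + s) = 2 * q + 2 * s := by ring
    set ψ : E [⋀^Fin (2 * q)]→L[ℝ] ℂ := kleimanDualPow η (2 * q) s (x.domDomCongr (finCongr hd)) with hψ_def
    have hψ : ψ ∈ divisorClasses Φ q := by
      refine kleimanDualPow_apply_mem_divisorClasses Φ hNS hnd q s rfl ?_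
      rw [domDomCongr_finCongr_trans, domDomCongr_finCongr_self]
      exact hx
    have hLψ : lefschetzPow η s (show 2 * s + 2 * q = 2 * q + 2 * s by ring) ψ = x.domDomCongr (finCongr hd) :=
      lefschetzPow_kleimanDualPow hnd hqs _ _
    have hψ0 : ψ ≠ 0 := by
      intro h0
      rw [h0, LinearMap.map_zero, eq_comm, domDomCongr_finCongr_eq_zero_iff] at hLψ
      exact hx0 hLψ
    have hkr : 2 * q + s = g := by omega
    obtain ⟨y, hy, hQ⟩ : ∃ y ∈ divisorClasses Φ q, lefschetzIntersectionForm Φ η e hkr ψ y ≠ 0 := by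
      by_contra! hall
      exact hψ0 (hη.eq_zero_of_forall_mem_divisorClasses_lefschetzIntersectionForm_eq_zero Φ e hkr hψ hall)
    refine ⟨y, hy, ?_⟩
    have hx_eq : x = ((wedgePow (ofRealForm η) s).wedge ψ).domDomCongr (finCongr (by ring)) := by
      rw [lefschetzPow_apply, eq_comm, ← domDomCongr_finCongr_inj hd.symm, domDomCongr_finCongr_trans,
        domDomCongr_finCongr_trans, domDomCongr_finCongr_self] at hLψ
      exact hLψ
    rw [lefschetzIntersectionForm_eq_neg_one_pow_mul Φ η e hkr (by omega)] at hQ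
    rw [hx_eq, domDomCongr_finCongr_wedge, domDomCongr_finCongr_trans,
      wedge_wedge_eq_domDomCongr_assoc' (wedgePow (ofRealForm η) s) ψ y, domDomCongr_finCongr_trans]
    exact fun h0 ↦ hQ (by rw [h0, mul_zero])

/-- **Milne's Prop. 5.2, second variable: `0 ≠ y ∈ D^q ⇒ ∃ x ∈ Dᵖ, ∫_X x ∧ y ≠ 0`** (`p + q = g`).
[cite: Milne1999LefschetzClasses, §5 Prop. 5.2] -/
theorem IsRiemannForm.exists_mem_divisorClasses_torusIntegral_wedge_ne_zero' (hη : IsRiemannForm Φ η)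
    {g : ℕ} (e : Fin (2 * g) ≃ ι) {p q : ℕ} (hpq : p + q = g) (h2 : 2 * p + 2 * q = 2 * g)
    {y : E [⋀^Fin (2 * q)]→L[ℝ] ℂ} (hy : y ∈ divisorClasses Φ q) (hy0 : y ≠ 0) :
    ∃ x ∈ divisorClasses Φ p, torusIntegral Φ e ((x.wedge y).domDomCongr (finCongr h2)) ≠ 0 := by
  obtain ⟨x, hx, h⟩ := hη.exists_mem_divisorClasses_torusIntegral_wedge_ne_zero Φ e
    (show q + p = g by omega) (show 2 * q + 2 * p = 2 * g by omega) hy hy0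
  exact ⟨x, hx, by rwa [torusIntegral_wedge_comm_of_even Φ e h2] at h⟩

/-- **The cup-product pairing `Dᵖ(X) × D^q(X) → ℚ` (`p + q = g`) of a polarised complex torus is a
PERFECT PAIRING of finite-dimensional `ℚ`-vector spaces** (Milne's Prop. 5.2 in both variables; the
pairing is the tree's `ℚ`-valued Poincaré pairing `poincarePairingRat Φ e h = ±∫_X · ∧ ·` restricted to
`Dᵖ ⊆ H^{2p}(X, ℚ)`, `D^q ⊆ H^{2q}(X, ℚ)`; "perfect" is Mathlib's `LinearMap.IsPerfPair`).
[cite: Milne1999LefschetzClasses, §5 Prop. 5.2] -/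
theorem IsRiemannForm.isPerfPair_poincarePairingRat_divisorClasses (hη : IsRiemannForm Φ η) {g : ℕ}
    (e : Fin (2 * g) ≃ ι) {p q : ℕ} (hpq : p + q = g) (h : 2 * p + 2 * q = 2 * g) :
    LinearMap.IsPerfPair (M := divisorClasses Φ p) (N := divisorClasses Φ q)
      ((poincarePairingRat Φ e h).compl₁₂
        (Submodule.inclusion ((divisorClasses_le_hodgeClasses Φ p).trans (hodgeClasses_le_rationalForms Φ p)))
        (Submodule.inclusion ((divisorClasses_le_hodgeClasses Φ q).trans (hodgeClasses_le_rationalForms Φ q)))) := by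
  haveI : FiniteDimensional ℚ (hodgeClasses Φ p) := finiteDimensional_hodgeClassesIn Φ _ _
  haveI : FiniteDimensional ℚ (divisorClasses Φ p) :=
    Submodule.finiteDimensional_of_le (divisorClasses_le_hodgeClasses Φ p)
  have hsign : (orientationSign Φ ((finCongr h).trans e) : ℂ) ≠ 0 := by
    rcases orientationSign_eq_or Φ ((finCongr h).trans e) with hs | hs <;> rw [hs] <;> norm_num
  refine LinearMap.IsPerfPair.of_injective ((injective_iff_map_eq_zero _).2 fun x hx ↦ ?_)
    ((injective_iff_map_eq_zero _).2 fun y hy ↦ ?_)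
  · by_contra hx0
    have hx0' : (x : E [⋀^Fin (2 * p)]→L[ℝ] ℂ) ≠ 0 := fun h0 ↦ hx0 (Subtype.ext h0)
    obtain ⟨y, hy, hI⟩ := hη.exists_mem_divisorClasses_torusIntegral_wedge_ne_zero Φ e hpq h x.2 hx0'
    have h1 := congrArg (fun t : ℚ ↦ (t : ℂ)) (LinearMap.congr_fun hx ⟨y, hy⟩)
    simp only [LinearMap.compl₁₂_apply, LinearMap.zero_apply, Rat.cast_zero,
      coe_poincarePairingRat_eq_orientationSign_mul_torusIntegral, Submodule.coe_inclusion,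
      mul_eq_zero, hsign, false_or] at h1
    exact hI h1
  · by_contra hy0
    have hy0' : (y : E [⋀^Fin (2 * q)]→L[ℝ] ℂ) ≠ 0 := fun h0 ↦ hy0 (Subtype.ext h0)
    obtain ⟨x, hx, hI⟩ := hη.exists_mem_divisorClasses_torusIntegral_wedge_ne_zero' Φ e hpq h y.2 hy0'
    have h1 := congrArg (fun t : ℚ ↦ (t : ℂ)) (LinearMap.congr_fun hy ⟨x, hx⟩)
    simp only [LinearMap.flip_apply, LinearMap.compl₁₂_apply, LinearMap.zero_apply, Rat.cast_zero,
      coe_poincarePairingRat_eq_orientationSign_mul_torusIntegral, Submodule.coe_inclusion,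
      mul_eq_zero, hsign, false_or] at h1
    exact hI h1

end Pairing

/-! ## §6 Kleiman's `A(X, L)` for Lefschetz classes: `Lᵗ : Dᵖ(X) ⥲ D^{p+t}(X)` (`2p + t = g`), and the
symmetry of "`Dᵖ = H^{2p}_Hodge`" about the middle codimension -/

section StrongLefschetz

variable {ι : Type*} [Fintype ι] {E : Type*} [NormedAddCommGroup E] [NormedSpace ℂ E]
  [FiniteDimensional ℂ E] (Φ : (ι → ℝ) ≃L[ℝ] E) {η : E [⋀^Fin 2]→L[ℝ] ℝ}

/-- **Every divisor class above the middle degree is `Lᵗ` of a divisor class**: for `2p + t = g` and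
`x ∈ D^{p+t}(X)` (read in degree `2p + 2t`), `x = Lᵗ(Λᵗx)` with `Λᵗx ∈ Dᵖ(X)` (row g7-#3: `Λᵗ` is the
inverse of the hard Lefschetz isomorphism; §4: `Λᵗ` preserves `D•`). [cite: Milne1999LefschetzClasses, §5 Rem. 5.11]
[cite: Milne2002Polarizations, Introduction pp. 599–600] -/
theorem exists_mem_divisorClasses_lefschetzPow_eq (hη : IsNSForm Φ η)
    (hnd : ∀ v : E, v ≠ 0 → ∃ w : E, η ![v, w] ≠ 0) {p t : ℕ} (hpt : 2 * p + t = finrank ℂ E)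
    {x : E [⋀^Fin (2 * p + 2 * t)]→L[ℝ] ℂ}
    (hx : x.domDomCongr (finCongr ((Nat.left_distrib 2 p t).symm)) ∈ divisorClasses Φ (p + t)) :
    ∃ y ∈ divisorClasses Φ p, lefschetzPow η t (show 2 * t + 2 * p = 2 * p + 2 * t by omega) y = x :=
  ⟨kleimanDualPow η (2 * p) t x, kleimanDualPow_apply_mem_divisorClasses Φ hη hnd p t rfl hx,
    lefschetzPow_kleimanDualPow hnd hpt _ x⟩

/-- **Kleiman's standard conjecture `A(X, L)` holds for the Lefschetz classes of a complex torus with a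
non-degenerate `η ∈ NS(X)`: `Lᵗ : Dᵖ(X) → D^{p+t}(X)` is a BIJECTION for `2p + t = g`** ("`L^{n-r} :
Hʳ(V) → H^{2n-r}(V)` is assumed to be an isomorphism … the operators `Λ` … are algebraic", Milne 2002
quoting Grothendieck / Kleiman; Milne 1999, after Thm. 5.9: "Most of (Kleiman 1968) can now be rewritten
with 'variety' replaced by 'abelian variety' and 'algebraic cycle' with 'Lefschetz cycle'"). Injective by
hard Lefschetz on all invariant forms, onto by `x = Lᵗ(Λᵗx)` with `Λᵗ` preserving `D•`.
[cite: Milne1999LefschetzClasses, §5 p. 665 (after Thm. 5.9) and Rem. 5.11]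
[cite: Milne2002Polarizations, Introduction pp. 599–600] -/
theorem lefschetzPow_bijOn_divisorClasses (hη : IsNSForm Φ η)
    (hnd : ∀ v : E, v ≠ 0 → ∃ w : E, η ![v, w] ≠ 0) {p t : ℕ} (hpt : 2 * p + t = finrank ℂ E) :
    Set.BijOn (lefschetzPow η t (show 2 * t + 2 * p = 2 * (p + t) by ring))
      (divisorClasses Φ p : Set (E [⋀^Fin (2 * p)]→L[ℝ] ℂ)) (divisorClasses Φ (p + t)) := by
  refine ⟨fun y hy ↦ lefschetzPow_mem_divisorClasses Φ hη t (Nat.add_comm t p) hy,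
    (lefschetzPow_bijective_of_add_eq hnd hpt _).1.injOn, fun x hx ↦ ?_⟩
  have hd : 2 * (p + t) = 2 * p + 2 * t := Nat.left_distrib 2 p t
  have hx' : (x.domDomCongr (finCongr hd)).domDomCongr (finCongr hd.symm) ∈ divisorClasses Φ (p + t) := by
    rw [domDomCongr_finCongr_trans, domDomCongr_finCongr_self]; exact hx
  obtain ⟨y, hy, h1⟩ := exists_mem_divisorClasses_lefschetzPow_eq Φ hη hnd hpt hx'
  refine ⟨y, hy, ?_⟩
  rw [lefschetzPow_apply] at h1 ⊢
  rw [← domDomCongr_finCongr_inj hd, domDomCongr_finCongr_trans]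
  exact h1

/-- **`dim_ℚ Dᵖ(X) = dim_ℚ D^{p+t}(X)` for `2p + t = g`** (`A(X, L)` for Lefschetz classes).
[cite: Milne1999LefschetzClasses, §5 p. 665 (after Thm. 5.9)]
[cite: Milne2002Polarizations, Introduction pp. 599–600] -/
theorem finrank_divisorClasses_eq_of_two_mul_add_eq (hη : IsNSForm Φ η)
    (hnd : ∀ v : E, v ≠ 0 → ∃ w : E, η ![v, w] ≠ 0) {p t : ℕ} (hpt : 2 * p + t = finrank ℂ E) :
    finrank ℚ (divisorClasses Φ p) = finrank ℚ (divisorClasses Φ (p + t)) := by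
  have hB := lefschetzPow_bijOn_divisorClasses Φ hη hnd hpt
  set L : (E [⋀^Fin (2 * p)]→L[ℝ] ℂ) →ₗ[ℚ] (E [⋀^Fin (2 * (p + t))]→L[ℝ] ℂ) :=
    (lefschetzPow η t (show 2 * t + 2 * p = 2 * (p + t) by ring)).restrictScalars ℚ with hL
  have hmaps : ∀ y ∈ divisorClasses Φ p, L y ∈ divisorClasses Φ (p + t) := fun y hy ↦ hB.1 hy
  have hbij : Function.Bijective (L.restrict hmaps) := by
    refine ⟨fun a b h ↦ Subtype.ext (hB.2.1 a.2 b.2 (congrArg Subtype.val h)), fun c ↦ ?_⟩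
    obtain ⟨y, hy, e⟩ := hB.2.2 c.2
    exact ⟨⟨y, hy⟩, Subtype.ext e⟩
  exact (LinearEquiv.ofBijective _ hbij).finrank_eq

/-- **The Hodge `(p,p)`-statement "`Dᵖ(X) = H^{2p}_Hodge(X)`" is symmetric about the middle codimension**:
for `2p + t = g`, `Dᵖ = H^{2p}_Hodge ↔ D^{t+p} = H^{2(t+p)}_Hodge`. `→` is the tree's hard-Lefschetz
transfer `divisorClasses_eq_hodgeClasses_of_two_mul_add_eq` (Lange §7.3.3 Exercise (2)(b), all `p`);
`←` is new: a Hodge class `x` of codimension `p` has `Lᵗx ∈ H^{2(t+p)}_Hodge = D^{t+p}`, so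
`x = Λᵗ Lᵗ x ∈ Dᵖ` (`Λᵗ` preserves `D•`, §4). [cite: Lange2023AbelianVarietiesComplex, §7.3.3 Exercise (2)(b)]
[cite: Milne1999LefschetzClasses, §5 Rem. 5.11] -/
theorem divisorClasses_eq_hodgeClasses_iff_of_two_mul_add_eq (hη : IsNSForm Φ η)
    (hnd : ∀ v : E, v ≠ 0 → ∃ w : E, η ![v, w] ≠ 0) {p t : ℕ} (hpt : 2 * p + t = finrank ℂ E) :
    divisorClasses Φ p = hodgeClasses Φ p ↔ divisorClasses Φ (t + p) = hodgeClasses Φ (t + p) := by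
  refine ⟨divisorClasses_eq_hodgeClasses_of_two_mul_add_eq Φ hη hnd hpt, fun h ↦ ?_⟩
  refine le_antisymm (divisorClasses_le_hodgeClasses Φ p) fun x hx ↦ ?_
  have hd : 2 * (t + p) = 2 * p + 2 * t := by ring
  -- `Lᵗ x` is a Hodge class of codimension `t + p`, hence a divisor class
  have hLx : lefschetzPow η t (show 2 * t + 2 * p = 2 * (t + p) by ring) x ∈ divisorClasses Φ (t + p) := by
    rw [h]; exact lefschetzPow_mem_hodgeClasses Φ hη t rfl hx
  have hLx' : (lefschetzPow η t (show 2 * t + 2 * p = 2 * p + 2 * t by ring) x).domDomCongr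
      (finCongr (by ring : 2 * p + 2 * t = 2 * (p + t))) ∈ divisorClasses Φ (p + t) := by
    have e : (lefschetzPow η t (show 2 * t + 2 * p = 2 * p + 2 * t by ring) x).domDomCongr
        (finCongr (by ring : 2 * p + 2 * t = 2 * (p + t))) =
        (lefschetzPow η t (show 2 * t + 2 * p = 2 * (t + p) by ring) x).domDomCongr
          (finCongr (congrArg (2 * ·) (Nat.add_comm t p))) := by
      rw [lefschetzPow_apply, lefschetzPow_apply, domDomCongr_finCongr_trans, domDomCongr_finCongr_trans]
    rw [e]
    exact domDomCongr_mem_divisorClasses Φ (Nat.add_comm t p) hLx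
  have hx' := kleimanDualPow_apply_mem_divisorClasses Φ hη hnd p t rfl hLx'
  rwa [kleimanDualPow_lefschetzPow hnd hpt.le] at hx'

end StrongLefschetz

end ComplexTorus

end Literature.Geometry.Kaehler
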